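import Summits.KontsevichZagierPeriods.KontsevichZagierPeriods.Theses.VietaFibre
import Summits.KontsevichZagierPeriods.KontsevichZagierPeriods.Theses.CoactionDevissage
import Literature.NumberTheory.Transcendental.KZProductIdeal
import Literature.NumberTheory.Transcendental.KZRulesAssociator
import HarnessLib

/-!
# Crux `KernelForm` (stmt-KontsevichZagierPeriods-10447), line `Sketch`: dictionary of the
# transcendence half `WeakKernel`

`WeakKernel := ∀ c : KZ.FormalRep, KZ.eval c = 0 → ∃ s, KZ.eval s ≠ 0 ∧ s * c ∈ KZ.relations`
(every class of value zero is killed by SOME multiplier of non-zero value: `𝔭 · P_𝔭 = 0` for the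
value prime `𝔭 = ker eval` of the formal period ring `P = KZ.FormalPeriodRing`) is the transcendence
half of the cut `KernelForm ↔ WeakKernel ∧ Cancellation`. It is the WEAKEST of the localised kernel
statements in the tree — each of them implies it (statements inline, no definitions):

* `weakKernel_of_kernelForm` — from the crux itself (`s = [pt, 1]`);
* `weakKernel_of_rationalKernel` — from route CoactionDevissage's `RationalKernel` (stmt-3165,
  `∃ n ≠ 0, n • c ∈ relations`): `s = n • [pt, 1]`;
* `weakKernel_of_piLocalKernel` — from `KZ.PiLocalKernel` (route AyoubSpecialisation's shape,
  `∃ N, [π]·([π]·(⋯ c)) ∈ relations`): `s = [π]^N`, re-associated in the commutative ring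
  `KZ.FormalPeriodRing`.

Nothing is claimed about `WeakKernel` itself (conjecture-grade, of the strength of Conjecture 1).

References: M. Kontsevich, D. Zagier, *Periods* (2001), §1.2, §4.1; J. Ayoub, *Periods and the
conjectures of Grothendieck and Kontsevich–Zagier*, EMS Newsl. 91 (2014), Conj. 7.
-/

noncomputable section

open Literature.NumberTheory.Transcendental
open Summit.KontsevichZagierPeriods.KontsevichZagierPeriods.Theses

namespace Summit.KontsevichZagierPeriods.KernelForm.LocaliseAtValuePrime

/-- `(n • x) * c = n • (x * c)` in the non-unital ring `KZ.FormalRep`. [folklore] -/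
theorem nsmul_mul' (n : ℕ) (x c : KZ.FormalRep) : (n • x) * c = n • (x * c) := by
  induction n with
  | zero => simp
  | succ m ih => rw [succ_nsmul, succ_nsmul, add_mul, ih]

/-- `KernelForm → WeakKernel`: the unit `[pt, 1]` (value `1`) multiplies relations into relations.
[folklore] -/
theorem weakKernel_of_kernelForm
    (hK : Summit.KontsevichZagierPeriods.KontsevichZagierPeriods.Theses.VietaFibre.KernelForm) :
    ∀ c : KZ.FormalRep, KZ.eval c = 0 → ∃ s : KZ.FormalRep, KZ.eval s ≠ 0 ∧ s * c ∈ KZ.relations := by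
  intro c hc
  refine ⟨KZ.of KZ.IntegralRep.unit, ?_, KZ.mul_mem_relations_left_holds _ _ (hK c hc)⟩
  rw [KZ.eval_of, KZ.IntegralRep.value_unit]; exact one_ne_zero

/-- **`RationalKernel → WeakKernel`** (route CoactionDevissage, stmt-3165): if `n • c ∈ relations`
with `n ≠ 0`, the multiplier `s = n • [pt, 1]` has value `n ≠ 0` and
`s * c = n • ([pt,1] * c) ≡ n • c`. [folklore] -/
theorem weakKernel_of_rationalKernel :
    Summit.KontsevichZagierPeriods.KontsevichZagierPeriods.Theses.CoactionDevissage.RationalKernel → ∀ c : KZ.FormalRep, KZ.eval c = 0 → ∃ s : KZ.FormalRep, KZ.eval s ≠ 0 ∧ s * c ∈ KZ.relations := by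
  intro hR c hc
  obtain ⟨n, hn, hnc⟩ := hR c hc
  refine ⟨n • KZ.of KZ.IntegralRep.unit, ?_, ?_⟩
  · rw [map_nsmul, KZ.eval_of, KZ.IntegralRep.value_unit, nsmul_eq_mul, mul_one]
    exact_mod_cast hn
  · rw [nsmul_mul']
    have h1 : KZ.of KZ.IntegralRep.unit * c - c ∈ KZ.relations := by
      have e : KZ.of KZ.IntegralRep.unit * c - c =
          (KZ.of KZ.IntegralRep.unit * c - c * KZ.of KZ.IntegralRep.unit) +
            (c * KZ.of KZ.IntegralRep.unit - c) := by abel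
      rw [e]
      exact KZ.relations.add_mem (KZ.mul_sub_mul_comm_mem_relations _ _)
        (KZ.mul_of_unit_sub_mem_relations c)
    have h2 := KZ.relations.nsmul_mem h1 n
    rw [nsmul_sub] at h2
    have e : n • (KZ.of KZ.IntegralRep.unit * c) = (n • (KZ.of KZ.IntegralRep.unit * c) - n • c) + n • c := by
      abel
    rw [e]
    exact KZ.relations.add_mem h2 hnc

/-- **`PiLocalKernel → WeakKernel`** (route AyoubSpecialisation's shape, `KZ.PiLocalKernel`): if the
left-nested `[π]·([π]·(⋯ c))` is a relation, then with `s = [π]·([π]·(⋯ [pt,1]))` (value `π^N ≠ 0`)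
also `s * c` is one — the two products have the same image `⟦π⟧^N ⟦c⟧` in the commutative ring
`KZ.FormalPeriodRing`. [folklore] -/
theorem weakKernel_of_piLocalKernel :
    KZ.PiLocalKernel → ∀ c : KZ.FormalRep, KZ.eval c = 0 → ∃ s : KZ.FormalRep, KZ.eval s ≠ 0 ∧ s * c ∈ KZ.relations := by
  intro hP c hc
  obtain ⟨N, hN⟩ := hP c hc
  refine ⟨(fun x => KZ.of KZ.piRep * x)^[N] (KZ.of KZ.IntegralRep.unit), ?_, ?_⟩
  · have hval : ∀ M : ℕ, KZ.eval ((fun x => KZ.of KZ.piRep * x)^[M] (KZ.of KZ.IntegralRep.unit)) =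
        Real.pi ^ M := by
      intro M
      induction M with
      | zero => simp [KZ.IntegralRep.value_unit]
      | succ M ih => rw [Function.iterate_succ_apply', KZ.eval_piRep_mul, ih, pow_succ, mul_comm]
    rw [hval]
    exact pow_ne_zero _ Real.pi_ne_zero
  · rw [← KZ.toFormalPeriod_eq_zero_iff] at hN ⊢
    have himg : ∀ (M : ℕ) (x : KZ.FormalRep),
        KZ.toFormalPeriod ((fun x => KZ.of KZ.piRep * x)^[M] x) =
          KZ.toFormalPeriod (KZ.of KZ.piRep) ^ M * KZ.toFormalPeriod x := by
      intro M x
      induction M with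
      | zero => simp
      | succ M ih => rw [Function.iterate_succ_apply', map_mul, ih, pow_succ]; ring
    rw [map_mul, himg, KZ.toFormalPeriod_of_unit, mul_one]
    rw [himg] at hN
    exact hN

end Summit.KontsevichZagierPeriods.KernelForm.LocaliseAtValuePrime
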